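import Summits.QuantumAdvantage.QuantumAdvantage.Theorems.CubicForrelationNearExactIsExactSixteenSplitBTools
import Summits.QuantumAdvantage.QuantumAdvantage.Theorems.CubicForrelationNearExactIsExactEighteenSixtyThreeSixtyFourths

/-!
# Crux `CubicForrelation.NearExactIsExact` (stmt-QuantumAdvantage-14043) — n = 18 two-sided analysis: budget, pairing and localisation tools

Certificate seat `b2b-cforr-cert` (gen 6).  HONEST FRAMING: preparatory lemmas for theorems about cubic Boolean pairs on 18 bits (finite slice
`n = 18` of the crux; the boundary value `Φ = 63/64` of the certified bound `θ₁₈ ≤ 63/64`) — NOT summit progress.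

With `W_g = 64u` (Ax on 18 bits), `s = (−1)^f` and the residual `τ = u − 8s` (a bent `g` has `|u| = 8`):
* `ep_budget18`: `Σ_x (u − 8s)² = 2²⁵·(1 − Φ(f,g))`  (so `Φ ≥ 63/64 ⟺ Σ τ² ≤ 2¹⁹`);
* `ep_pairing18`: `Σ_y (−1)^{g(y)}·τ̂(y) = Σ_x τ(x)W_g(x) = 2³⁰·(1 − Φ(f,g))` (`= 2²⁴` at the boundary);
* `ep_tau_one`, `ep_tau_three`: `τ = ±1 ⇒ τ = (−1)^{d₁}`, `τ² = 9 ⇒ τ = −3(−1)^{d₁}` (`d₁ = [⌊u/2⌋ odd]`);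
* `ep_loc3` (general `n`): localisation of a parametrised `(k+3)`-flat sum to the inner `k`-flat when the integrand vanishes on the seven
  translates; `ep_dirs3`: three directions inside `U` avoiding `V₀` with all seven combinations when `4·#V₀ < #U`.

References: J. Ax (1964) / R. J. McEliece (1972); R. O'Donnell (2014) §1.4, §3.3; S. Aaronson, A. Ambainis, SIAM J. Comput. 47 (2018) §1.1.1.
Everything below is proved from Mathlib and the tree; axioms are the standard three.
-/

set_option linter.dupNamespace false -- D-0017: single-problem summit ⇒ `QuantumAdvantage.QuantumAdvantage` by design

noncomputable section

namespace Summit.QuantumAdvantage.QuantumAdvantage.Theorems.CubicForrelation.NearExactIsExact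

open Finset
open Literature.Computability.QuantumComplexity
open Literature.Computability.QuantumComplexity.BuzetChailloux (bxor zeroVec bxor_bxor_cancel_left bxor_zeroVec zeroVec_bxor bxor_comm
  bxor_self)
open Literature.Computability.QuantumComplexity.DerivativeWalsh (W)

variable {n : ℕ}

/-! ### Budget and pairing on 18 bits -/

/-- **Two-sided budget on 18 bits.** With `W_g = 64u` and `s = (−1)^f`: `Σ_x (u − 8s)² = 2²⁵·(1 − Φ(f,g))`. [this work] -/
theorem ep_budget18 (f g : (Fin (9 + 9) → Bool) → Bool) (u : (Fin (9 + 9) → Bool) → ℤ)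
    (hu : ∀ x, W (fun y => signOf (g y)) x = (2 : ℝ) ^ 6 * (u x : ℝ)) :
    ((∑ x, (u x - 8 * sZ (f x)) ^ 2 : ℤ) : ℝ) = (2 : ℝ) ^ 25 * (1 - forrelation f g) := by
  have hsq : ∑ x, ((u x : ℝ)) ^ 2 = 2 ^ 24 := by exact_mod_cast ei_sum_u_sq g u hu
  have hΦ := vg_two_pow_mul_forrelation f g
  have e : ∀ x : Fin (9 + 9) → Bool, ((u x : ℝ) - 8 * (sZ (f x) : ℝ)) ^ 2 =
      (u x : ℝ) ^ 2 - (1 / 4) * (signOf (f x) * W (fun y => signOf (g y)) x) + 64 := by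
    intro x
    have hs2 : signOf (f x) ^ 2 = 1 := BuzetChailloux.signOf_sq _
    rw [tp_sZ_cast, hu x]
    nlinarith [hs2]
  push_cast
  rw [sum_congr rfl fun x _ => e x, sum_add_distrib, sum_sub_distrib, ← mul_sum, hsq, ← hΦ, sum_const, card_univ,
    Fintype.card_fun, Fintype.card_bool, Fintype.card_fin]
  norm_num
  ring

/-- **The two-sided pairing identity on 18 bits.** With `W_g = 64u`: `Σ_y (−1)^{g(y)}·(u − 8(−1)^f)^(y) = 2³⁰·(1 − Φ(f,g))`. [this work] -/
theorem ep_pairing18 (f g : (Fin (9 + 9) → Bool) → Bool) (u : (Fin (9 + 9) → Bool) → ℤ)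
    (hu : ∀ x, W (fun y => signOf (g y)) x = (2 : ℝ) ^ 6 * (u x : ℝ)) :
    ∑ y, signOf (g y) * W (fun x => (u x : ℝ) - 8 * signOf (f x)) y = (2 : ℝ) ^ 30 * (1 - forrelation f g) := by
  rw [fl1_pairing]
  have hΦ := vg_two_pow_mul_forrelation f g
  have hsq : ∑ x, ((u x : ℝ)) ^ 2 = 2 ^ 24 := by exact_mod_cast ei_sum_u_sq g u hu
  have e : ∀ x, ((u x : ℝ) - 8 * signOf (f x)) * W (fun y => signOf (g y)) x =
      64 * (u x : ℝ) ^ 2 - 8 * (signOf (f x) * W (fun y => signOf (g y)) x) := by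
    intro x; rw [hu x]; ring
  rw [sum_congr rfl fun x _ => e x, sum_sub_distrib, ← mul_sum, ← mul_sum, hsq, ← hΦ]
  norm_num
  ring

/-! ### The residual on odd points in terms of the digit `d₁` (residual `v − 8s`) -/

/-- `|v − 8s| = 1` ⇒ `v − 8s = (−1)^{[⌊v/2⌋ odd]}`. [folklore] -/
theorem ep_tau_one {v s : ℤ} (h : v - 8 * s = 1 ∨ v - 8 * s = -1) : v - 8 * s = sZ (decide (Odd (v / 2))) := by
  rcases h with h | h
  · have hv : v / 2 = 4 * s := by omega
    have hev : ¬ Odd (v / 2) := by rw [hv, Int.not_odd_iff_even]; exact ⟨2 * s, by ring⟩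
    rw [h, decide_eq_false hev]; rfl
  · have hv : v / 2 = 4 * s - 1 := by omega
    have hod : Odd (v / 2) := by rw [hv]; exact ⟨2 * s - 1, by ring⟩
    rw [h, decide_eq_true hod]; rfl

/-- `(v − 8s)² = 9` ⇒ `v − 8s = −3·(−1)^{[⌊v/2⌋ odd]}`. [folklore] -/
theorem ep_tau_three {v s : ℤ} (h : (v - 8 * s) ^ 2 = 9) : v - 8 * s = -3 * sZ (decide (Odd (v / 2))) := by
  have h3 : v - 8 * s = 3 ∨ v - 8 * s = -3 := by
    have : (v - 8 * s - 3) * (v - 8 * s + 3) = 0 := by nlinarith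
    rcases mul_eq_zero.1 this with h1 | h1
    · left; linarith
    · right; linarith
  rcases h3 with h3 | h3
  · have hv : v / 2 = 4 * s + 1 := by omega
    have hod : Odd (v / 2) := by rw [hv]; exact ⟨2 * s, by ring⟩
    rw [h3, decide_eq_true hod]; rfl
  · have hv : v / 2 = 4 * s - 2 := by omega
    have hev : ¬ Odd (v / 2) := by rw [hv, Int.not_odd_iff_even]; exact ⟨2 * s - 1, by ring⟩
    rw [h3, decide_eq_false hev]; rfl

/-! ### Three transversal directions and localisation -/

/-- **Three transversal directions inside `U`.** If `4·#V₀ < #U` there are `t₁, t₂, t₃ ∈ U` whose seven non-trivial combinations avoid `V₀`.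
[folklore] -/
theorem ep_dirs3 (U V₀ : Finset (Fin n → Bool)) (hcard : 4 * #V₀ < #U) :
    ∃ t₁ ∈ U, ∃ t₂ ∈ U, ∃ t₃ ∈ U,
      t₁ ∉ V₀ ∧ t₂ ∉ V₀ ∧ bxor t₂ t₁ ∉ V₀ ∧ t₃ ∉ V₀ ∧ bxor t₃ t₁ ∉ V₀ ∧ bxor t₃ t₂ ∉ V₀ ∧ bxor t₃ (bxor t₂ t₁) ∉ V₀ := by
  have hz : ∀ d : Fin n → Bool, bxor zeroVec d = d := zeroVec_bxor
  have hc : ∀ a b : Fin n → Bool, bxor a b = bxor b a := bxor_comm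
  obtain ⟨t₁, h₁U, h₁⟩ := fl1_avoid U V₀ [zeroVec] (by simp only [List.length_singleton]; omega)
  have e₁ : t₁ ∉ V₀ := by simpa only [hz] using h₁ zeroVec (by simp)
  obtain ⟨t₂, h₂U, h₂⟩ := fl1_avoid U V₀ [zeroVec, t₁] (by simp only [List.length_cons, List.length_nil]; omega)
  have e₂ : t₂ ∉ V₀ := by simpa only [hz] using h₂ zeroVec (by simp)
  have e₂₁ : bxor t₂ t₁ ∉ V₀ := by rw [hc]; exact h₂ t₁ (by simp)
  obtain ⟨t₃, h₃U, h₃⟩ := fl1_avoid U V₀ [zeroVec, t₁, t₂, bxor t₂ t₁]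
    (by simp only [List.length_cons, List.length_nil]; omega)
  have e₃ : t₃ ∉ V₀ := by simpa only [hz] using h₃ zeroVec (by simp)
  refine ⟨t₁, h₁U, t₂, h₂U, t₃, h₃U, e₁, e₂, e₂₁, e₃, ?_, ?_, ?_⟩
  · rw [hc]; exact h₃ t₁ (by simp)
  · rw [hc]; exact h₃ t₂ (by simp)
  · rw [hc]; exact h₃ (bxor t₂ t₁) (by simp)

/-- **Localisation with three outer directions.** If `F` vanishes at the seven translates `q ⊕ t_S` (non-empty `S ⊆ {1,2,3}`) of every point
`q` of the inner parametrised `k`-flat, then the parametrised `(k+3)`-flat sum with outer directions `t₁, t₂, t₃` equals the inner sum.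
[folklore] -/
theorem ep_loc3 {k : ℕ} (F : (Fin n → Bool) → ℤ) (x t₁ t₂ t₃ : Fin n → Bool) (a : Fin k → Fin n → Bool)
    (h1 : ∀ ε : Fin k → Bool, F (bxor (fun j => x j ^^ decide (Odd #(univ.filter fun i => ε i && a i j))) t₁) = 0)
    (h2 : ∀ ε : Fin k → Bool, F (bxor (fun j => x j ^^ decide (Odd #(univ.filter fun i => ε i && a i j))) t₂) = 0)
    (h21 : ∀ ε : Fin k → Bool, F (bxor (bxor (fun j => x j ^^ decide (Odd #(univ.filter fun i => ε i && a i j))) t₂) t₁) = 0)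
    (h3 : ∀ ε : Fin k → Bool, F (bxor (fun j => x j ^^ decide (Odd #(univ.filter fun i => ε i && a i j))) t₃) = 0)
    (h31 : ∀ ε : Fin k → Bool, F (bxor (bxor (fun j => x j ^^ decide (Odd #(univ.filter fun i => ε i && a i j))) t₃) t₁) = 0)
    (h32 : ∀ ε : Fin k → Bool, F (bxor (bxor (fun j => x j ^^ decide (Odd #(univ.filter fun i => ε i && a i j))) t₃) t₂) = 0)
    (h321 : ∀ ε : Fin k → Bool,
      F (bxor (bxor (bxor (fun j => x j ^^ decide (Odd #(univ.filter fun i => ε i && a i j))) t₃) t₂) t₁) = 0) :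
    ∑ ε : Fin (k + 3) → Bool, F (fun j => x j ^^ decide (Odd #(univ.filter fun i =>
        ε i && (Matrix.vecCons t₁ (Matrix.vecCons t₂ (Matrix.vecCons t₃ a)) : Fin (k + 3) → Fin n → Bool) i j))) =
      ∑ ε : Fin k → Bool, F (fun j => x j ^^ decide (Odd #(univ.filter fun i => ε i && a i j))) := by
  have inner : ∀ (G : (Fin n → Bool) → ℤ),
      (∀ ε : Fin k → Bool, G (fun j => x j ^^ decide (Odd #(univ.filter fun i => ε i && a i j))) = 0) →
      (∀ ε : Fin k → Bool, G (bxor (fun j => x j ^^ decide (Odd #(univ.filter fun i => ε i && a i j))) t₃) = 0) →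
      ∀ ε : Fin (k + 1) → Bool, G (fun j => x j ^^ decide (Odd #(univ.filter fun i =>
        ε i && (Matrix.vecCons t₃ a : Fin (k + 1) → Fin n → Bool) i j))) = 0 := by
    intro G g0 g3 ε
    have hpt : (fun j => x j ^^ decide (Odd #(univ.filter fun i =>
        ε i && (Matrix.vecCons t₃ a : Fin (k + 1) → Fin n → Bool) i j))) =
        bxor (fun j => x j ^^ decide (Odd #(univ.filter fun i => (Fin.tail ε) i && a i j))) (fun j => ε 0 && t₃ j) := by
      have e1 : ε = Fin.cons (ε 0) (Fin.tail ε) := (Fin.cons_self_tail ε).symm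
      conv_lhs => rw [e1]
      show (fun j => x j ^^ decide (Odd #(univ.filter fun i : Fin (k + 1) =>
        (Fin.cons (ε 0) (Fin.tail ε) : Fin (k + 1) → Bool) i && (Fin.cons t₃ a : Fin (k + 1) → Fin n → Bool) i j))) = _
      rw [erm_flatPt_cons]
    rw [hpt]
    cases ε 0 <;>
      simp only [Bool.true_and, Bool.false_and, es_bxor_false, show (fun j => t₃ j) = t₃ from rfl, g0, g3]
  rw [sp_loc2 F x t₁ t₂ (Matrix.vecCons t₃ a)]
  · have p3 := fr_sum_peel F x t₃ a
    rw [p3, sum_eq_zero fun ε _ => h3 ε, add_zero]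
  · exact inner (fun y => F (bxor y t₁)) h1 h31
  · exact inner (fun y => F (bxor y t₂)) h2 h32
  · exact inner (fun y => F (bxor (bxor y t₂) t₁)) h21 h321

end Summit.QuantumAdvantage.QuantumAdvantage.Theorems.CubicForrelation.NearExactIsExact

end
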